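import Mathlib
import Literature.Computability.AlgebraicComplexity.GroupTheoreticMatMul
import Summits.MatrixMultiplication.MatrixMultiplication.Theorems.GroupTheoreticSTPPCThesisPackingSumset
import Summits.MatrixMultiplication.OmegaCensus.STPPDisjointPacking

/-!
# No four `(4,4,4)` STPP triples in an abelian group of order `124` (T_E residual Q3.11, second multiset)

Support file for route `MatrixMultiplication/GroupTheoreticSTPP`, crux `stmt-MatrixMultiplication-0597`,
cell `mm-stpp` (D-0046), CENSUS-PLAN §6.1 Q3.11; memo `HOME/mm-stpp-eng-2/TE-RESIDUALS.md` §0–§1 (mm-stpp-eng-2).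

Bookkeeping for a census-STPP family (`IsSTPP`) in a finite abelian group `H`, with the difference families
`D = ⋃ (A t − B t)`, `E = ⋃ (B t − C t)`, `F = ⋃ (C t − A t)` (disjoint unions, `|D| = Σ|A t||B t|` etc.) and the
representation count `r(x) = #{e ∈ E : x − e ∈ F} = #{(e,f) ∈ E × F : e + f = x}`:

* `card_filter_rep_eq` — for `d ∈ A i − B i`, `r(−d) = |C i|` exactly (the STPP clause forces every
  representation into block `i`; this is the per-block count behind the cell's «U11-min» / Theorem A);
* `sum_rep_compl` — `Σ_{x ∉ −D} r(x) = |E||F| − Σ_t |A t||B t||C t|`, and `r(x) ≤ |F|` always;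
* `no_isSTPP_444x4_order124` — **no `IsSTPP` family of four `(4,4,4)` triples exists in any abelian group of
  order `124`**: here `Σ_{x ∉ −D} r(x) = 3840 = 60 · 64` over the `60` elements outside `−D`, so `r(x) = 64 = |F|`
  for each of them, i.e. `x − F = E`; hence `E` is invariant under the `≥ 60` translations `x − x'`, its
  stabiliser is a subgroup of order `≥ 60` dividing `124`, so of order `62` or `124`, and `E` (64 elements) would
  contain two of its cosets — `≥ 124` elements.

WHAT THIS IS NOT: no `ω` statement; one residual multiset of the abelian T_E census at one order.
-/

-- single-conjunct summit: the mandated namespace repeats `MatrixMultiplication`.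
set_option linter.dupNamespace false

namespace Summit.MatrixMultiplication.MatrixMultiplication.Theorems

namespace STPPEnergy

open Finset Literature.Computability.AlgebraicComplexity
open scoped Pointwise

variable {H : Type*} [AddCommGroup H] [Fintype H] [DecidableEq H] {N : ℕ} {A B C : Fin N → Finset H}

omit [Fintype H] in
/-- Membership in the union of difference sets `⋃ (X t − Y t)`. [folklore] -/
theorem mem_biUnion_sub {X Y : Fin N → Finset H} {x : H} :
    x ∈ (univ.biUnion fun t => X t - Y t) ↔ ∃ t, ∃ a ∈ X t, ∃ b ∈ Y t, a - b = x := by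
  simp only [mem_biUnion, mem_univ, true_and, mem_sub]

omit [Fintype H] in
/-- `|⋃ (A t − B t)| = Σ |A t||B t|` for an `IsSTPP` family with all `C t` non-empty. [original] -/
theorem card_biUnion_sub (h : IsSTPP A B C) (hC : ∀ t, (C t).Nonempty) :
    (univ.biUnion fun t => A t - B t).card = ∑ t, (A t).card * (B t).card := by
  rw [card_biUnion]
  · exact sum_congr rfl fun t _ => STPPPackingSumset.card_sub_eq h t (hC t)
  · intro t _ t' _ htt'
    exact STPPPackingSumset.disjoint_sub_sub h htt' (hC t')

/-- `Σ_x #{e ∈ E : x − e ∈ F} = |E|·|F|` (each `e` contributes `|F|` values of `x`); the same statement as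
`STPPNoFour444.sum_card_filter_sub_mem` (eng-1), re-proved here while that module's build is pending. [folklore] -/
theorem sum_card_filter_rep (E F : Finset H) :
    ∑ x, (E.filter fun e => x - e ∈ F).card = E.card * F.card := by
  simp_rw [card_filter]
  rw [sum_comm]
  have : ∀ e ∈ E, (∑ x, if x - e ∈ F then 1 else 0) = F.card := by
    intro e _
    rw [← card_filter]
    refine card_bij (fun x _ => x - e) (fun x hx => (mem_filter.1 hx).2) (fun x₁ _ x₂ _ h12 => ?_)
      (fun f hf => ⟨f + e, by simp [hf], by simp⟩)
    simpa using h12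
  rw [sum_congr rfl this, sum_const, smul_eq_mul]

omit [Fintype H] in
/-- **Representation count.** For `d ∈ A i − B i`, the number of `e ∈ E = ⋃(B t − C t)` with
`−d − e ∈ F = ⋃(C t − A t)` is exactly `|C i|`. [original] -/
theorem card_filter_rep_eq (h : IsSTPP A B C) (i : Fin N) {d : H} (hd : d ∈ A i - B i) :
    ((univ.biUnion fun t => B t - C t).filter fun e =>
        -d - e ∈ univ.biUnion fun t => C t - A t).card = (C i).card := by
  rw [mem_sub] at hd
  obtain ⟨s', hs', t₀, ht₀, rfl⟩ := hd
  symm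
  refine card_bij (fun u _ => t₀ - u) (fun u hu => ?_) (fun u₁ _ u₂ _ huu => by simpa using huu) ?_
  · rw [mem_filter, mem_biUnion_sub, mem_biUnion_sub]
    refine ⟨⟨i, t₀, ht₀, u, hu, rfl⟩, i, u, hu, s', hs', ?_⟩
    abel
  · intro e he
    rw [mem_filter, mem_biUnion_sub, mem_biUnion_sub] at he
    obtain ⟨⟨j, t', ht', u, hu, rfl⟩, k, u', hu', s, hs, hsu⟩ := he
    have key : (s' - s) + (t' - t₀) + (u' - u) = 0 := by
      have : u' = s + (-(s' - t₀) - (t' - u)) := by rw [← hsu]; abel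
      rw [this]; abel
    obtain ⟨hij, -, -, ht, huu⟩ := h i j k s hs s' hs' t₀ ht₀ t' ht' u hu u' hu' key
    subst hij
    exact ⟨u, hu, by rw [ht, huu]⟩

omit [Fintype H] in
/-- `r(x) ≤ |F|`: the representations `e ↦ x − e` inject into `F`. [original] -/
theorem card_filter_rep_le (E F : Finset H) (x : H) :
    (E.filter fun e => x - e ∈ F).card ≤ F.card := by
  refine card_le_card_of_injOn (fun e => x - e) (fun e he => ?_) (fun e₁ _ e₂ _ hee => ?_)
  · exact (mem_filter.1 he).2
  · simpa using hee

omit [Fintype H] in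
/-- If `r(x) = |F|` then `x − f ∈ E` for every `f ∈ F`. [original] -/
theorem sub_mem_of_card_filter_rep_eq (E F : Finset H) (x : H)
    (hx : (E.filter fun e => x - e ∈ F).card = F.card) {f : H} (hf : f ∈ F) : x - f ∈ E := by
  have hsurj := surj_on_of_inj_on_of_card_le (s := E.filter fun e => x - e ∈ F) (t := F)
    (fun e _ => x - e) (fun e he => (mem_filter.1 he).2) (fun e₁ e₂ _ _ hee => by simpa using hee)
    hx.ge
  obtain ⟨e, he, hef⟩ := hsurj f hf
  have : x - f = e := by rw [hef]; abel
  rw [this]; exact (mem_filter.1 he).1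

/-- `Σ_x r(x)` splits as the contribution `Σ_t |A t||B t||C t|` of `−D` plus the rest. [original] -/
theorem sum_rep_compl (h : IsSTPP A B C) (hC : ∀ t, (C t).Nonempty) :
    ∑ x ∈ univ \ (univ.biUnion fun t => A t - B t).image Neg.neg,
        ((univ.biUnion fun t => B t - C t).filter fun e =>
          x - e ∈ univ.biUnion fun t => C t - A t).card
      + ∑ t, (A t).card * (B t).card * (C t).card
      = (univ.biUnion fun t => B t - C t).card * (univ.biUnion fun t => C t - A t).card := by
  rw [← sum_card_filter_rep (univ.biUnion fun t => B t - C t) (univ.biUnion fun t => C t - A t)]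
  have hsplit := sum_sdiff (f := fun x => ((univ.biUnion fun t => B t - C t).filter fun e =>
      x - e ∈ univ.biUnion fun t => C t - A t).card)
    (subset_univ ((univ.biUnion fun t => A t - B t).image Neg.neg))
  rw [← hsplit]
  congr 1
  rw [sum_image (fun x _ y _ hxy => neg_injective hxy)]
  rw [sum_biUnion]
  · refine sum_congr rfl fun t _ => ?_
    rw [sum_congr rfl fun d hd => card_filter_rep_eq h t hd, sum_const, smul_eq_mul,
      STPPPackingSumset.card_sub_eq h t (hC t)]
  · intro t _ t' _ htt'
    exact STPPPackingSumset.disjoint_sub_sub h htt' (hC t')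

/-- **No `IsSTPP` family of four `(4,4,4)` triples in an abelian group of order `124`.** [original] -/
theorem no_isSTPP_444x4_order124 (hH : Fintype.card H = 124) (A B C : Fin 4 → Finset H)
    (hA : ∀ i, (A i).card = 4) (hB : ∀ i, (B i).card = 4) (hC : ∀ i, (C i).card = 4) :
    ¬ IsSTPP A B C := by
  intro h
  have hAne : ∀ i, (A i).Nonempty := fun i => card_pos.1 (by rw [hA i]; norm_num)
  have hBne : ∀ i, (B i).Nonempty := fun i => card_pos.1 (by rw [hB i]; norm_num)
  have hCne : ∀ i, (C i).Nonempty := fun i => card_pos.1 (by rw [hC i]; norm_num)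
  set D := univ.biUnion fun t => A t - B t with hDdef
  set E := univ.biUnion fun t => B t - C t with hEdef
  set F := univ.biUnion fun t => C t - A t with hFdef
  have hDc : D.card = 64 := by
    rw [hDdef, card_biUnion_sub h hCne]; simp [hA, hB]
  have hEc : E.card = 64 := by
    rw [hEdef, card_biUnion_sub (OmegaCensus.stpp_rotate h) hAne]; simp [hB, hC]
  have hFc : F.card = 64 := by
    rw [hFdef, card_biUnion_sub (OmegaCensus.stpp_rotate (OmegaCensus.stpp_rotate h)) hBne]; simp [hC, hA]
  -- the complement X of −D
  set X := univ \ D.image Neg.neg with hXdef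
  have hDimg : (D.image Neg.neg).card = 64 := by rw [card_image_of_injective _ neg_injective, hDc]
  have hXc : X.card = 60 := by
    rw [hXdef, card_sdiff_of_subset (subset_univ _), card_univ, hH, hDimg]
  -- representation counts on X sum to 3840 = 60 * 64, each ≤ 64, hence each = 64
  set r : H → ℕ := fun x => (E.filter fun e => x - e ∈ F).card with hrdef
  have hsum : ∑ x ∈ X, r x = 3840 := by
    have := sum_rep_compl h hCne
    simp only [hA, hB, hC, Fin.sum_univ_four] at this
    rw [← hDdef, ← hEdef, ← hFdef, hEc, hFc, ← hXdef] at this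
    simp only [hrdef]
    omega
  have hle : ∀ x, r x ≤ 64 := fun x => (card_filter_rep_le E F x).trans hFc.le
  have hrx : ∀ x ∈ X, r x = 64 :=
    (sum_eq_sum_iff_of_le fun x _ => hle x).1 (by rw [hsum, sum_const, hXc, smul_eq_mul])
  -- hence x − f ∈ E for all x ∈ X, f ∈ F, and E is stable under the translations x' − x
  have hsub : ∀ x ∈ X, ∀ f ∈ F, x - f ∈ E := fun x hx f hf =>
    sub_mem_of_card_filter_rep_eq E F x ((hrx x hx).trans hFc.symm) hf
  have himg : ∀ x ∈ X, F.image (fun f => x - f) = E := by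
    intro x hx
    apply eq_of_subset_of_card_le
    · intro y hy
      rw [mem_image] at hy
      obtain ⟨f, hf, rfl⟩ := hy
      exact hsub x hx f hf
    · rw [card_image_of_injective _ (fun f₁ f₂ h12 => by simpa using h12), hFc, hEc]
  have hstab : ∀ x ∈ X, ∀ x' ∈ X, ∀ e ∈ E, e + (x' - x) ∈ E := by
    intro x hx x' hx' e he
    rw [← himg x hx, mem_image] at he
    obtain ⟨f, hf, rfl⟩ := he
    have : x - f + (x' - x) = x' - f := by abel
    rw [this]
    exact hsub x' hx' f hf
  -- the stabiliser subgroup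
  let K : AddSubgroup H :=
    { carrier := {g | ∀ e ∈ E, e + g ∈ E}
      zero_mem' := by intro e he; simpa using he
      add_mem' := by
        intro a b ha hb e he
        have : e + (a + b) = (e + a) + b := by abel
        rw [this]; exact hb _ (ha _ he)
      neg_mem' := by
        intro a ha e he
        -- translation by `a` maps `E` into `E`, hence onto `E`
        have hsurj := surj_on_of_inj_on_of_card_le (s := E) (t := E) (fun e _ => e + a)
          (fun e he => ha e he) (fun e₁ e₂ _ _ h12 => by simpa using h12) le_rfl
        obtain ⟨e', he', hee'⟩ := hsurj e he
        have : e + -a = e' := by rw [hee']; abel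
        rw [this]; exact he' }
  have hKmem : ∀ g, g ∈ K ↔ ∀ e ∈ E, e + g ∈ E := fun g => Iff.rfl
  -- |K| ≥ 60 : it contains X − x₀
  obtain ⟨x₀, hx₀⟩ : X.Nonempty := card_pos.1 (by rw [hXc]; norm_num)
  haveI : DecidablePred (· ∈ K) := fun g => decidable_of_iff _ (hKmem g).symm
  have hKcard : Nat.card K = (univ.filter fun g => g ∈ K).card := by
    rw [Nat.card_eq_fintype_card, ← Fintype.card_subtype]
  have hK60 : 60 ≤ Nat.card K := by
    rw [hKcard, ← hXc]
    refine card_le_card_of_injOn (fun x' => x' - x₀) (fun x' hx' => ?_) (fun a _ b _ hab => by simpa using hab)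
    rw [coe_filter]
    exact ⟨mem_univ _, (hKmem _).2 (hstab x₀ hx₀ x' hx')⟩
  have hKdvd : Nat.card K ∣ 124 := by
    have := AddSubgroup.card_addSubgroup_dvd_card K
    rwa [Nat.card_eq_fintype_card (α := H), hH] at this
  -- a coset of K inside E
  obtain ⟨e₀, he₀⟩ : E.Nonempty := card_pos.1 (by rw [hEc]; norm_num)
  set KF := univ.filter fun g => g ∈ K with hKFdef
  have hI₀ : (KF.image fun g => g + e₀) ⊆ E := by
    intro y hy
    rw [mem_image] at hy
    obtain ⟨g, hg, rfl⟩ := hy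
    rw [add_comm]
    exact ((hKmem g).1 (mem_filter.1 hg).2) e₀ he₀
  have hI₀c : (KF.image fun g => g + e₀).card = Nat.card K := by
    rw [card_image_of_injective _ (fun a b hab => by simpa using hab), hKcard]
  have hK64 : Nat.card K ≤ 64 := by
    rw [← hI₀c, ← hEc]; exact card_le_card hI₀
  have hK62 : Nat.card K = 62 := by
    obtain ⟨q, hq⟩ := hKdvd
    have hlo : 60 * q ≤ Nat.card K * q := Nat.mul_le_mul_right q hK60
    have hhi : Nat.card K * q ≤ 64 * q := Nat.mul_le_mul_right q hK64
    have hq2 : q = 2 := by omega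
    subst hq2; omega
  -- a second, disjoint coset
  have hlt : (KF.image fun g => g + e₀).card < E.card := by rw [hI₀c, hK62, hEc]; norm_num
  obtain ⟨e₁, he₁E, he₁I⟩ := exists_of_ssubset (ssubset_of_subset_of_ne hI₀ (fun heq => by
    rw [heq] at hlt; exact lt_irrefl _ hlt))
  have hI₁ : (KF.image fun g => g + e₁) ⊆ E := by
    intro y hy
    rw [mem_image] at hy
    obtain ⟨g, hg, rfl⟩ := hy
    rw [add_comm]
    exact ((hKmem g).1 (mem_filter.1 hg).2) e₁ he₁E
  have hdisj : Disjoint (KF.image fun g => g + e₀) (KF.image fun g => g + e₁) := by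
    rw [disjoint_left]
    intro y hy hy'
    rw [mem_image] at hy hy'
    obtain ⟨g, hg, rfl⟩ := hy
    obtain ⟨g', hg', hgg⟩ := hy'
    apply he₁I
    rw [mem_image]
    refine ⟨g - g', mem_filter.2 ⟨mem_univ _, K.sub_mem (mem_filter.1 hg).2 (mem_filter.1 hg').2⟩, ?_⟩
    have : e₁ = g + e₀ - g' := by rw [← hgg]; abel
    rw [this]; abel
  have hI₁c : (KF.image fun g => g + e₁).card = 62 := by
    rw [card_image_of_injective _ (fun a b hab => by simpa using hab), ← hKcard, hK62]
  have := card_le_card (union_subset hI₀ hI₁)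
  rw [card_union_of_disjoint hdisj, hI₀c, hK62, hI₁c, hEc] at this
  omega

/-! ### The per-member packing inequality («U11-min», Kemperman–Scherk–Wehn form of Theorem A) -/

/-- **Per-member packing inequality (U11-min, C-form).** For an `IsSTPP` family with non-empty sets in a
finite abelian group (`A t`, `B t` non-empty) and ANY member `i`: `Σ_t |B t||C t| + Σ_t |C t||A t| ≤ |H| + |C i|`.
Proof: for
`d ∈ A i − B i` the sets `E = ⋃(B t − C t)` and `−d − F`, `F = ⋃(C t − A t)`, meet in exactly `r(−d) = |C i|`
points (`card_filter_rep_eq`), so `|E ∪ (−d − F)| = |E| + |F| − |C i| ≤ |H|`.  This is the cell's rule U11-min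
(lit KNESER-KILLS §1, planner CENSUS-PLAN §3; it implies eng-1's sharp form p403985 and Theorem A p402899).
[cite: Kemperman1956] [cite: CohnKleinbergSzegedyUmans2005, Def. 5.1] -/
theorem sum_card_mul_add_sum_card_mul_le (h : IsSTPP A B C) (hA : ∀ t, (A t).Nonempty)
    (hB : ∀ t, (B t).Nonempty) (i : Fin N) :
    ∑ t, (B t).card * (C t).card + ∑ t, (C t).card * (A t).card
      ≤ Fintype.card H + (C i).card := by
  classical
  obtain ⟨a, ha⟩ := hA i
  obtain ⟨b, hb⟩ := hB i
  have hd : a - b ∈ A i - B i := sub_mem_sub ha hb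
  set E := univ.biUnion fun t => B t - C t with hEdef
  set F := univ.biUnion fun t => C t - A t with hFdef
  have hEc : E.card = ∑ t, (B t).card * (C t).card := card_biUnion_sub (OmegaCensus.stpp_rotate h) hA
  have hFc : F.card = ∑ t, (C t).card * (A t).card :=
    card_biUnion_sub (OmegaCensus.stpp_rotate (OmegaCensus.stpp_rotate h)) hB
  set x : H := -(a - b) with hxdef
  set I := F.image fun f => x - f with hIdef
  have hIc : I.card = F.card := card_image_of_injective _ fun f₁ f₂ h12 => by simpa using h12
  have hinter : E ∩ I = E.filter fun e => x - e ∈ F := by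
    ext e
    simp only [mem_inter, mem_filter, hIdef, mem_image]
    constructor
    · rintro ⟨he, f, hf, rfl⟩
      exact ⟨he, by simpa using hf⟩
    · rintro ⟨he, hxe⟩
      exact ⟨he, x - e, hxe, by simp⟩
  have hrep : (E.filter fun e => x - e ∈ F).card = (C i).card := card_filter_rep_eq h i hd
  have h1 := card_union_add_card_inter E I
  have h2 : (E ∪ I).card ≤ Fintype.card H := card_le_univ _
  rw [hinter, hrep, hIc] at h1
  omega

/-- **U11-min, A-form**: `Σ|C t||A t| + Σ|A t||B t| ≤ |H| + |A i|` for every member `i` (rotation of the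
C-form). [cite: Kemperman1956] -/
theorem sum_card_mul_add_sum_card_mul_le₂ (h : IsSTPP A B C) (hB : ∀ t, (B t).Nonempty)
    (hC : ∀ t, (C t).Nonempty) (i : Fin N) :
    ∑ t, (C t).card * (A t).card + ∑ t, (A t).card * (B t).card
      ≤ Fintype.card H + (A i).card :=
  sum_card_mul_add_sum_card_mul_le (OmegaCensus.stpp_rotate h) hB hC i

/-- **U11-min, B-form**: `Σ|A t||B t| + Σ|B t||C t| ≤ |H| + |B i|` for every member `i`. [cite: Kemperman1956] -/
theorem sum_card_mul_add_sum_card_mul_le₃ (h : IsSTPP A B C) (hC : ∀ t, (C t).Nonempty)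
    (hA : ∀ t, (A t).Nonempty) (i : Fin N) :
    ∑ t, (A t).card * (B t).card + ∑ t, (B t).card * (C t).card
      ≤ Fintype.card H + (B i).card :=
  sum_card_mul_add_sum_card_mul_le (OmegaCensus.stpp_rotate (OmegaCensus.stpp_rotate h)) hC hA i

end STPPEnergy

end Summit.MatrixMultiplication.MatrixMultiplication.Theorems
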